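import Summits.AtomisticToContinuum.Crystallization.Theorems.SlackRigidity.Negative.WitnessBasics

/-!
# `KeplerBound` (stmt-AtomisticToContinuum-11961) from bulk rigidity, IIb: matched environments

Support file for the item `ThreeConeCertificate.KeplerBound`.  Deterministic bookkeeping about ONE
finite configuration `x : Fin N → ℝ³` of `δ`-separated points, one particle `i`, and one periodic
configuration `P` with `δ`-separated points, used by the energy argument
`BulkDefectVanish → KeplerBound`:

* § Matching — if the `R`-environment of `x i` is two-way `ε`-matched (`2ε < δ`) to
  `x i + A (P.points − y)` for a centre `y ∈ P.points` and a linear isometry `A`, the matching is an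
  injection `φ` from `T = {q ∈ P.points : 0 < dist q y ≤ R}` into the other particles, distorting
  distances to the centre by `≤ ε` and covering every particle within `R − ε` of `x i`
  (`exists_matching`).
* § Comparison — along such an injection, for any potential `V` non-positive on the far particles,
  `siteEnergy V x i ≥ Σ_{q ∈ T} V(a q) − #T·ω + Σ_{far} V` (`siteEnergy_ge_of_matching`).
* § Recentring — a particle matched to `P` about the origin at radius `R + 2` is matched, at radius
  `R` and tolerance `2ε`, to `P` about ANY of its points `y`, given a vertex-transitivity datum at
  `y` (`matchedAt_of_good`).

All `[folklore]`.
-/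

noncomputable section

open scoped BigOperators Topology
open Filter Set Metric

namespace Summit.AtomisticToContinuum.Crystallization.Theorems.KeplerBoundBulk

open Literature.MathematicalPhysics.StatisticalMechanics
open Summit.AtomisticToContinuum.Crystallization.Theorems.SlackRigidityNegative

/-! ## § The matching injection -/

/-- The distance from `x i` to the image point `x i + A (q - y)` is `dist q y`. [folklore] -/
theorem dist_add_map_sub (A : E3 →ₗᵢ[ℝ] E3) (z q y : E3) : dist (z + A (q - y)) z = dist q y := by
  rw [dist_add_linearIsometry, dist_eq_norm]

/-- **Two-way matching is an injection.** Let the `R`-environment of `x i` be two-way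
`ε`-matched to `x i + A (P.points − y)` (`y ∈ P.points`), with `x` and `P.points` both
`δ`-separated and `2ε < δ`.  Then choosing for each `q ∈ T = {q ∈ P.points : q ≠ y, dist q y ≤ R}`
the particle near `x i + A (q − y)` defines a map `φ` which avoids `i`, is injective on `T`,
distorts the distance to the centre by at most `ε`, and whose image contains every particle
`j ≠ i` within `R − ε` of `x i`. [folklore] -/
theorem exists_matching {P : PeriodicConfiguration 3} {y : E3} {R ε δ : ℝ} {N : ℕ}
    {x : Fin N → E3} {i : Fin N} {A : E3 →ₗᵢ[ℝ] E3} {T : Finset E3}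
    (hT : ∀ q, q ∈ T ↔ q ∈ P.points ∧ q ≠ y ∧ dist q y ≤ R) (hy : y ∈ P.points)
    (ha : ∀ q ∈ P.points, dist q y ≤ R → ∃ j, dist (x j) (x i + A (q - y)) ≤ ε)
    (hb : ∀ j, dist (x j) (x i) ≤ R → ∃ q ∈ P.points, dist (x j) (x i + A (q - y)) ≤ ε)
    (hxsep : ∀ k l, k ≠ l → δ ≤ dist (x k) (x l))
    (hPsep : ∀ p ∈ P.points, ∀ q ∈ P.points, p ≠ q → δ ≤ dist p q)
    (hε : 0 ≤ ε) (hεδ : 2 * ε < δ) :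
    ∃ φ : E3 → Fin N, (∀ q ∈ T, φ q ≠ i) ∧ Set.InjOn φ T ∧
      (∀ q ∈ T, |dist (x i) (x (φ q)) - dist q y| ≤ ε) ∧
      ∀ j, j ≠ i → dist (x j) (x i) ≤ R - ε → ∃ q ∈ T, φ q = j := by
  classical
  haveI : Nonempty (Fin N) := ⟨i⟩
  have hch : ∀ q, q ∈ T → ∃ j, dist (x j) (x i + A (q - y)) ≤ ε := fun q hq => by
    obtain ⟨hqP, -, hqR⟩ := (hT q).1 hq
    exact ha q hqP hqR
  choose! φ hφ using hch
  -- distance distortion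
  have hdist : ∀ q ∈ T, |dist (x i) (x (φ q)) - dist q y| ≤ ε := fun q hq => by
    rw [dist_comm (x i), ← dist_add_map_sub A (x i) q y]
    exact (abs_dist_sub_le (x (φ q)) (x i + A (q - y)) (x i)).trans (hφ q hq)
  refine ⟨φ, fun q hq hqi => ?_, fun q₁ hq₁ q₂ hq₂ h12 => ?_, hdist, fun j hji hjR => ?_⟩
  · -- `φ q ≠ i`: otherwise `dist q y ≤ ε < δ`
    obtain ⟨hqP, hqy, -⟩ := (hT q).1 hq
    have h1 := hdist q hq
    rw [hqi, dist_self, zero_sub, abs_neg, abs_of_nonneg dist_nonneg] at h1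
    have h2 := hPsep q hqP y hy hqy
    linarith
  · -- injective on `T`: two preimages would be `2ε`-close points of `P`
    by_contra hne
    obtain ⟨hq₁P, -, -⟩ := (hT q₁).1 hq₁
    obtain ⟨hq₂P, -, -⟩ := (hT q₂).1 hq₂
    have hsep := hPsep q₁ hq₁P q₂ hq₂P hne
    have hd : dist q₁ q₂ ≤ 2 * ε :=
      calc dist q₁ q₂ = dist (x i + A (q₁ - y)) (x i + A (q₂ - y)) := by
            rw [dist_add_left, LinearIsometry.dist_map, dist_sub_right]
        _ ≤ dist (x i + A (q₁ - y)) (x (φ q₁)) + dist (x (φ q₁)) (x i + A (q₂ - y)) :=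
            dist_triangle _ _ _
        _ ≤ ε + ε := by
            refine add_le_add ?_ ?_
            · rw [dist_comm]; exact hφ q₁ hq₁
            · rw [h12]; exact hφ q₂ hq₂
        _ = 2 * ε := by ring
    linarith
  · -- coverage of the `(R − ε)`-ball
    obtain ⟨q, hqP, hq⟩ := hb j (by linarith)
    have h1 : |dist (x j) (x i) - dist q y| ≤ dist (x j) (x i + A (q - y)) := by
      rw [← dist_add_map_sub A (x i) q y]
      exact abs_dist_sub_le (x j) (x i + A (q - y)) (x i)
    have h2 := (abs_sub_le_iff.1 (h1.trans hq))
    have hji' := hxsep j i hji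
    have hqy : q ≠ y := fun h => by
      rw [h, dist_self] at h2
      linarith [h2.1]
    have hqT : q ∈ T := (hT q).2 ⟨hqP, hqy, by linarith [h2.2]⟩
    refine ⟨q, hqT, ?_⟩
    by_contra hne
    have hsep := hxsep j (φ q) (Ne.symm hne)
    have hd : dist (x j) (x (φ q)) ≤ 2 * ε :=
      calc dist (x j) (x (φ q)) ≤ dist (x j) (x i + A (q - y)) + dist (x i + A (q - y)) (x (φ q)) :=
            dist_triangle _ _ _
        _ ≤ ε + ε := add_le_add hq (by rw [dist_comm]; exact hφ q hqT)
        _ = 2 * ε := by ring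
    linarith

/-! ## § Comparison of site energies along a matching -/

/-- **A matching bounds the site energy from below.** If `φ` maps `T` injectively into the
particles other than `i`, with `|V(|x i − x (φ q)|) − V(a q)| ≤ ω` on `T`, and every particle
`j ≠ i` within `ρ` of `x i` is in the image, and `V ≤ 0` on the far particles, then
`siteEnergy V x i ≥ Σ_{q ∈ T} V(a q) − #T·ω + Σ_{far} V`. [folklore] -/
theorem siteEnergy_ge_of_matching (V : ℝ → ℝ) {N : ℕ} (x : Fin N → E3) (i : Fin N)
    {T : Finset E3} (φ : E3 → Fin N) (a : E3 → ℝ) {ω ρ : ℝ}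
    (h1 : ∀ q ∈ T, φ q ≠ i) (h2 : Set.InjOn φ T)
    (h3 : ∀ q ∈ T, |V (dist (x i) (x (φ q))) - V (a q)| ≤ ω)
    (h4 : ∀ j, j ≠ i → dist (x j) (x i) ≤ ρ → ∃ q ∈ T, φ q = j)
    (hneg : ∀ k, k ≠ i → ρ < dist (x i) (x k) → V (dist (x i) (x k)) ≤ 0) :
    ∑ q ∈ T, V (a q) - T.card * ω +
        ∑ k ∈ (Finset.univ.erase i).filter (fun k => ρ < dist (x i) (x k)), V (dist (x i) (x k)) ≤
      siteEnergy V x i := by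
  classical
  set f : Fin N → ℝ := fun k => V (dist (x i) (x k)) with hf
  set S : Finset (Fin N) := T.image φ with hS
  set far := (Finset.univ.erase i).filter (fun k => ρ < dist (x i) (x k)) with hfar
  have hSsub : S ⊆ Finset.univ.erase i := by
    intro k hk
    obtain ⟨q, hq, rfl⟩ := Finset.mem_image.1 hk
    exact Finset.mem_erase.2 ⟨h1 q hq, Finset.mem_univ _⟩
  -- split the site energy along `S`
  have hsplit : siteEnergy V x i = ∑ k ∈ S, f k + ∑ k ∈ Finset.univ.erase i \ S, f k := by
    unfold siteEnergy
    rw [← Finset.sum_sdiff hSsub, add_comm]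
  -- the matched part
  have hS_eq : ∑ k ∈ S, f k = ∑ q ∈ T, f (φ q) := Finset.sum_image fun q hq q' hq' h => h2 hq hq' h
  have hS_ge : ∑ q ∈ T, V (a q) - T.card * ω ≤ ∑ k ∈ S, f k := by
    rw [hS_eq]
    have : ∑ q ∈ T, (V (a q) - ω) ≤ ∑ q ∈ T, f (φ q) :=
      Finset.sum_le_sum fun q hq => by
        have := (abs_sub_le_iff.1 (h3 q hq)).2
        simp only [hf]
        linarith
    rw [Finset.sum_sub_distrib, Finset.sum_const, nsmul_eq_mul] at this
    exact this
  -- the unmatched part lies in the far region, where `V ≤ 0`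
  have hDsub : Finset.univ.erase i \ S ⊆ far := by
    intro k hk
    obtain ⟨hk1, hk2⟩ := Finset.mem_sdiff.1 hk
    have hki : k ≠ i := Finset.ne_of_mem_erase hk1
    refine Finset.mem_filter.2 ⟨hk1, ?_⟩
    by_contra hle
    rw [not_lt, dist_comm] at hle
    obtain ⟨q, hq, hqk⟩ := h4 k hki hle
    exact hk2 (Finset.mem_image.2 ⟨q, hq, hqk⟩)
  have hD_ge : ∑ k ∈ far, f k ≤ ∑ k ∈ Finset.univ.erase i \ S, f k := by
    rw [← Finset.sum_sdiff hDsub]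
    have : ∑ k ∈ far \ (Finset.univ.erase i \ S), f k ≤ 0 :=
      Finset.sum_nonpos fun k hk => by
        have hkfar := (Finset.mem_sdiff.1 hk).1
        obtain ⟨hk1, hk2⟩ := Finset.mem_filter.1 hkfar
        exact hneg k (Finset.ne_of_mem_erase hk1) hk2
    linarith
  rw [hsplit]
  linarith

/-! ## § Recentring a matching at another point of `P` -/

/-- **Recentring.** If the `(R+2)`-environment of `x i` is two-way `ε`-matched to
`x i + A (P.points)` (`Good`, centre `0`) and `P` about `y` is two-way `ε`-matched to `B (P.points)`
up to radius `R + 1` (the vertex-transitivity datum of part I), then the `R`-environment of `x i`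
is two-way `2ε`-matched to `x i + A' (P.points − y)` with `A' = A ∘ B⁻¹`. [folklore] -/
theorem matchedAt_of_good {P : PeriodicConfiguration 3} {y : E3} {R ε : ℝ} {N : ℕ}
    {x : Fin N → E3} {i : Fin N} (hε1 : ε ≤ 1)
    (hgood : Good P (R + 2) ε x i) (B : E3 →ₗᵢ[ℝ] E3)
    (hBa : ∀ q ∈ P.points, ‖q‖ ≤ R + 1 → ∃ q' ∈ P.points, dist q' (y + B q) ≤ ε)
    (hBb : ∀ q' ∈ P.points, dist q' y ≤ R + 1 → ∃ q ∈ P.points, dist q' (y + B q) ≤ ε) :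
    ∃ A' : E3 →ₗᵢ[ℝ] E3,
      (∀ q' ∈ P.points, dist q' y ≤ R → ∃ j, dist (x j) (x i + A' (q' - y)) ≤ 2 * ε) ∧
      (∀ j, dist (x j) (x i) ≤ R → ∃ q' ∈ P.points, dist (x j) (x i + A' (q' - y)) ≤ 2 * ε) := by
  obtain ⟨A, ha, hb⟩ := hgood
  set Be : E3 ≃ₗᵢ[ℝ] E3 := B.toLinearIsometryEquiv rfl with hBe
  have hBe_apply : ∀ v, Be v = B v := fun v => rfl
  set A' : E3 →ₗᵢ[ℝ] E3 := A.comp Be.symm.toLinearIsometry with hA'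
  have hkey : ∀ q q' : E3, dist q' (y + B q) ≤ ε →
      dist (x i + A q) (x i + A' (q' - y)) ≤ ε := by
    intro q q' hqq'
    have e1 : dist (x i + A q) (x i + A' (q' - y)) = dist q (Be.symm (q' - y)) := by
      rw [dist_add_left, hA']
      exact A.dist_map q (Be.symm (q' - y))
    have e2 : dist q (Be.symm (q' - y)) = dist (Be q) (q' - y) := by
      rw [← Be.dist_map q (Be.symm (q' - y)), Be.apply_symm_apply]
    have e3 : dist (Be q) (q' - y) = dist q' (y + B q) := by
      rw [hBe_apply, dist_comm, dist_eq_norm, dist_eq_norm]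
      congr 1
      abel
    rw [e1, e2, e3]
    exact hqq'
  refine ⟨A', fun q' hq' hq'R => ?_, fun j hjR => ?_⟩
  · obtain ⟨q, hqP, hq⟩ := hBb q' hq' (by linarith)
    have hqn : ‖q‖ ≤ R + 2 := by
      rw [← dist_add_linearIsometry B y q]
      calc dist (y + B q) y ≤ dist (y + B q) q' + dist q' y := dist_triangle _ _ _
        _ ≤ ε + R := by rw [dist_comm] at hq; linarith
        _ ≤ R + 2 := by linarith
    obtain ⟨j, hj⟩ := ha q hqP hqn
    refine ⟨j, ?_⟩
    calc dist (x j) (x i + A' (q' - y)) ≤ dist (x j) (x i + A q) + dist (x i + A q) (x i + A' (q' - y)) :=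
          dist_triangle _ _ _
      _ ≤ ε + ε := add_le_add hj (hkey q q' hq)
      _ = 2 * ε := by ring
  · obtain ⟨p, hpP, hp⟩ := hb j (by linarith)
    have hpn : ‖p‖ ≤ R + 1 := by
      rw [← dist_add_linearIsometry A (x i) p]
      calc dist (x i + A p) (x i) ≤ dist (x i + A p) (x j) + dist (x j) (x i) := dist_triangle _ _ _
        _ ≤ ε + R := by rw [dist_comm] at hp; linarith
        _ ≤ R + 1 := by linarith
    obtain ⟨q'', hq''P, hq''⟩ := hBa p hpP hpn
    refine ⟨q'', hq''P, ?_⟩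
    calc dist (x j) (x i + A' (q'' - y)) ≤ dist (x j) (x i + A p) + dist (x i + A p) (x i + A' (q'' - y)) :=
          dist_triangle _ _ _
      _ ≤ ε + ε := add_le_add hp (hkey p q'' hq'')
      _ = 2 * ε := by ring

end Summit.AtomisticToContinuum.Crystallization.Theorems.KeplerBoundBulk

end
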